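import Literature.Geometry.Kaehler.ComplexTorusIntegralHodgeLatticeTopMinimalClassValueGroup
import Literature.Geometry.Kaehler.ComplexTorusLefschetzFormPrimitiveLattice
import HarnessLib

/-!
# The defect of the top splitting: `I'_p = J_p · [γ_p^⊥ : ⊕_{s<p} γ_s ∧ Hdg^{p−s}(X, ℤ)_prim]`, and the `p = 1` end `I'_1 = J_1`

Layer `Literature/Geometry/Kaehler`, namespace `Literature.Geometry.Kaehler.ComplexTorus`; lane `lit-hodgefound`
(Track 2 foundations library), seat p09, generation 49, row g49-#2. THEOREMS ONLY (0 definitions); no named fact, net debt 0.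
g48-#4/#5 (`ComplexTorusIntegralHodgeLatticeLefschetzPiecesMinimalClasses`, `…TopMinimalClassSplitting`) built the tower of finite-index sublattices

  `Hdgᵖ(X, ℤ) ⊇ ℤγ_p ⊕ γ_p^⊥ ⊇ ⊕_{s ≤ p} M_s ⊇ ⊕_{s ≤ p} N_s`

of the integral Hodge lattice of a polarised abelian variety of type `(d₁, …, d_g)` (`k = 2p`, `2p + q = g`, `B = ⟨·, γ_q ∧ ·⟩_e`, Lefschetz pieces
`N_s = Lˢ Hdg^{p−s}(X, ℤ)_prim`, minimal-class pieces `M_s = γ_s ∧ Hdg^{p−s}(X, ℤ)_prim` with `N_s = (s!·d₁⋯d_s)·M_s`, top piece `M_p = ℤγ_p`) with the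
indices `J_p = [Hdgᵖ : ℤγ_p ⊕ γ_p^⊥] ∣ I'_p = [Hdgᵖ : ⊕ M_s] ∣ I_p = [Hdgᵖ : ⊕ N_s]`, `I_p = I'_p · ∏_s (s!·d₁⋯d_s)^{ρ_pr^{(p−s)}}`. This file names the
quotient `I'_p / J_p`: it is the index of the LOWER minimal-class pieces inside the orthogonal complement of the minimal class.

* §0 lattice generalities (private): `[A ⊕ B : A ⊕ B'] = [B : B']` (modular law) and pulling back a supremum of sublattices of `M` along `M ↪ H`.
* §1 **`⊕_{s ≤ p} M_s = ℤγ_p ⊕ (⊕_{s < p} M_s)` inside `Hdgᵖ(X, ℤ)` and `⊕_{s < p} M_s ⊆ γ_p^⊥`** (`IsPolarizationType.comap_subtype_iSup_minimalClassPieces_eq_line_sup_lower`,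
  `….comap_subtype_lower_minimalClassPieces_le_orthogonal`).
* §2 **THE DEFECT FORMULA `I'_p = J_p · D_p`, `D_p := [γ_p^⊥ : ⊕_{s < p} γ_s ∧ Hdg^{p−s}(X, ℤ)_prim]`**
  (`IsPolarizationType.index_comap_iSup_minimalClassPieces_eq_index_top_splitting_mul_relIndex_lower`), in both currencies (traces on the sub-module
  `M = Hdgᵖ(X, ℤ) ⊆ H^{2p}(X, ℤ)` and pull-backs along `Hdgᵖ(X, ℤ) ↪ H^{2p}(X, ℤ)`); `0 < D_p`, `D_p ∣ I'_p`; with g48-#4: `I_p = J_p · D_p · ∏_s (s!·d₁⋯d_s)^{rk M_s}`.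
* §3 **THE `p = 1` END: `γ₁^⊥ = Hdg¹(X, ℤ)_prim = M_0` exactly** (`B₂(γ₁, x) = 0 ⟺ θ^{∧(g−1)} ∧ x = 0 ⟺ x` primitive, g42-#8), hence **`D_1 = 1` and
  `I'_1 = J_1 = [Hdg¹(X, ℤ) : ℤγ₁ ⊕ Hdg¹(X, ℤ)_prim]`** (`IsPolarizationType.index_comap_iSup_minimalClassPieces_eq_index_top_splitting_of_degree_two`): for divisors
  the minimal-class decomposition IS the top splitting, so g48-#6's sharp formula reads `I'_1 · n₁ · d₁ = g · d_g` (`n₁ = [B₂(γ₁, H²(X, ℤ)) : B₂(γ₁, Hdg¹(X, ℤ))]`).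

## References

* [cite: Lange2023AbelianVarietiesComplex, §5.4.1 Thm. 5.4.2 and (5.22)–(5.23) (PDF p. 275); §2.5.3 Thm. 2.5.16, Cor. 2.5.17 (d) (PDF p. 135); §7.3.2 (1), (3); §6.2.4 (PDF p. 310)]
* [cite: VoisinHodgeI2002, §6.2.3 Thm. 6.25, Cor. 6.26, Rem. 6.27 (PDF pp. 125–126); §6.3.2 Lemma 6.31 (PDF p. 128); §7.1.2 (PDF p. 134)]
* [cite: Kaplansky1954, §7 Thm. 5 (PDF p. 18)]
* [cite: Huybrechts2016K3, Ch. 14 §0.1–§0.2 (PDF p. 333)]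
* [cite: Kitaoka1993, Ch. 5 Prop. 5.3.3 (proof)]
-/

noncomputable section

-- `Module ℂ` / `SMulZeroClass ℂ` synthesis on `E [⋀^Fin k]→L[ℝ] ℂ` (as in `ComplexTorusLefschetzDecomposition`)
set_option maxSynthPendingDepth 3

open Module Function Complex
open LinearMap (BilinForm)
open Literature.LinearAlgebra.Alternating
open Literature.Analysis.Complex (IsOfTypeAt typeSubmodule mem_typeSubmodule_iff_isOfTypeAt oneForm₀)

namespace Literature.Geometry.Kaehler.ComplexTorus

/-! ## §0 Lattice generalities -/

section Generic

variable {R V : Type*} [Ring R] [AddCommGroup V] [Module R V]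

/-- `(A ⊔ B).toAddSubgroup = A.toAddSubgroup ⊔ B.toAddSubgroup`. [folklore] -/
private theorem sup_toAddSubgroup₉₈ (A B : Submodule R V) : (A ⊔ B).toAddSubgroup = A.toAddSubgroup ⊔ B.toAddSubgroup := by
  refine le_antisymm ?_ (sup_le (Submodule.toAddSubgroup_mono le_sup_left) (Submodule.toAddSubgroup_mono le_sup_right))
  intro x hx
  obtain ⟨a, ha, b, hb, rfl⟩ := Submodule.mem_sup.1 hx
  exact AddSubgroup.add_mem _ (AddSubgroup.mem_sup_left ha) (AddSubgroup.mem_sup_right hb)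

/-- `[A ⊕ B : A ⊕ B'] = [B : B']` for submodules `A`, `B' ⊆ B` with `A ⊓ B = 0` (modular law + second isomorphism theorem). [folklore] -/
private theorem relIndex_sup_left_eq₉₈ {A B B' : Submodule R V} (hAB : A ⊓ B = ⊥) (hB' : B' ≤ B) :
    (A ⊔ B').toAddSubgroup.relIndex (A ⊔ B).toAddSubgroup = B'.toAddSubgroup.relIndex B.toAddSubgroup := by
  have hmod : (A ⊔ B') ⊓ B = B' := by
    rw [sup_comm A B', sup_inf_assoc_of_le A hB', hAB, sup_bot_eq]
  have hsup : B.toAddSubgroup ⊔ (A ⊔ B').toAddSubgroup = (A ⊔ B).toAddSubgroup := by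
    rw [← sup_toAddSubgroup₉₈, sup_left_comm, sup_eq_left.2 hB']
  have hinf : (A ⊔ B').toAddSubgroup ⊓ B.toAddSubgroup = ((A ⊔ B') ⊓ B).toAddSubgroup := AddSubgroup.ext fun _ ↦ Iff.rfl
  calc (A ⊔ B').toAddSubgroup.relIndex (A ⊔ B).toAddSubgroup
      = (A ⊔ B').toAddSubgroup.relIndex (B.toAddSubgroup ⊔ (A ⊔ B').toAddSubgroup) := by rw [hsup]
    _ = (A ⊔ B').toAddSubgroup.relIndex B.toAddSubgroup := AddSubgroup.relIndex_sup_right _ _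
    _ = ((A ⊔ B').toAddSubgroup ⊓ B.toAddSubgroup).relIndex B.toAddSubgroup := (AddSubgroup.inf_relIndex_right _ _).symm
    _ = B'.toAddSubgroup.relIndex B.toAddSubgroup := by rw [hinf, hmod]

/-- Pulling back along the inclusion of a submodule `W` is injective on the submodules of `W`: `S, S' ⊆ W`, `S.comap ι = S'.comap ι ⟹ S = S'`,
stated as: `comap ι (S ⊔ S') = comap ι S ⊔ comap ι S'` for `S, S' ⊆ W`. [folklore] -/
private theorem comap_subtype_sup_of_le₉₈ (W S S' : Submodule R V) (hS : S ≤ W) (hS' : S' ≤ W) :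
    (S ⊔ S').comap W.subtype = S.comap W.subtype ⊔ S'.comap W.subtype := by
  refine Submodule.map_injective_of_injective W.injective_subtype ?_
  rw [Submodule.map_sup, Submodule.map_comap_subtype, Submodule.map_comap_subtype, Submodule.map_comap_subtype,
    inf_eq_right.2 hS, inf_eq_right.2 hS', inf_eq_right.2 (sup_le hS hS')]

/-- `I = J·D`, `0 < I` give `0 < D`. [folklore] -/
private theorem pos_of_eq_mul_of_pos₉₈ {I J D : ℕ} (h : I = J * D) (hI : 0 < I) : 0 < D :=
  Nat.pos_of_ne_zero fun h0 ↦ by rw [h0, mul_zero] at h; omega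

/-- `I = J·D`, `D = 1` give `I = J`. [folklore] -/
private theorem eq_of_eq_mul_of_eq_one₉₈ {I J D : ℕ} (h : I = J * D) (h1 : D = 1) : I = J := by
  rw [h, h1, mul_one]

/-- `I = J·D`, `I = J`, `0 < J` give `D = 1`. [folklore] -/
private theorem eq_one_of_eq_mul_of_eq₉₈ {I J D : ℕ} (h : I = J * D) (hIJ : I = J) (hJ : 0 < J) : D = 1 :=
  Nat.eq_of_mul_eq_mul_left hJ (by rw [← h, hIJ, mul_one])

end Generic

/-! ## §1 `⊕_{s ≤ p} M_s = ℤγ_p ⊕ (⊕_{s < p} M_s)` and `⊕_{s < p} M_s ⊆ γ_p^⊥` -/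

section Lower

variable {ι : Type*} [Fintype ι] [DecidableEq ι] {E : Type*} [NormedAddCommGroup E] [NormedSpace ℂ E]
  {Φ : (ι → ℝ) ≃L[ℝ] E} {j n p q : ℕ} {η : E [⋀^Fin 2]→L[ℝ] ℝ} {d : Fin (j + 2) → ℕ}

omit [Fintype ι] [DecidableEq ι] in
/-- `⊕_{s ≤ p} M_s = M_p ⊔ ⊕_{s < p} M_s` (splitting the last index off a `Fin (p + 1)`-indexed supremum). [folklore] -/
private theorem iSup_eq_last_sup_iSup_castSucc₉₈ {k : ℕ} (M : Fin (p + 1) → Submodule ℤ ↥(integralForms Φ k)) :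
    (⨆ s, M s) = M (Fin.last p) ⊔ ⨆ s : Fin p, M (Fin.castSucc s) := by
  refine le_antisymm (iSup_le fun s ↦ ?_) (sup_le (le_iSup M _) (iSup_le fun t ↦ le_iSup M _))
  rcases Fin.eq_castSucc_or_eq_last s with ⟨t, rfl⟩ | rfl
  · exact le_sup_of_le_right (le_iSup (fun t : Fin p ↦ M (Fin.castSucc t)) t)
  · exact le_sup_left

/-- **THE LOWER MINIMAL-CLASS PIECES ARE ORTHOGONAL TO THE MINIMAL CLASS: `⊕_{s < p} M_s ⊆ γ_p^⊥`** inside the Hodge lattice `M = Hdgᵖ(X, ℤ)` (`B(γ_p, M_s) = 0`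
for `s < p`, g48-#5 §3; `γ_p^⊥ = Λ^⊥` for `B∣M`, `Λ = ℤγ_p`). [cite: VoisinHodgeI2002, §6.3.2 Lemma 6.31 (PDF p. 128)] [cite: Lange2023AbelianVarietiesComplex, §5.4.1 Thm. 5.4.2 and (5.22) (PDF p. 275)] -/
theorem IsPolarizationType.comap_subtype_lower_minimalClassPieces_le_orthogonal (hd : IsPolarizationType Φ η d) (hη : IsRiemannForm Φ η)
    (hp : p ≤ j + 2) (hkq : 2 * p + q = j + 2) (hq : q ≤ j + 2)
    {γq : E [⋀^Fin (2 * q)]→L[ℝ] ℂ} (hγq : wedgePow (ofRealForm η) q = ((q.factorial * ∏ i : Fin q, d (Fin.castLE hq i) : ℕ) : ℂ) • γq)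
    (e : Fin n ≃ ι) (hn : 2 * p + (2 * q + 2 * p) = n) {B : BilinForm ℤ ↥(integralForms Φ (2 * p))}
    (hB : ∀ x y : ↥(integralForms Φ (2 * p)),
      ((B x y : ℤ) : ℂ) = poincarePairing Φ e hn (x : E [⋀^Fin (2 * p)]→L[ℝ] ℂ) (γq.wedge (y : E [⋀^Fin (2 * p)]→L[ℝ] ℂ)))
    (γM : ↥(AddSubgroup.toIntSubmodule ((integralHodgeClassesIn Φ (2 * p) p).addSubgroupOf (integralForms Φ (2 * p)))))
    (hγM : wedgePow (ofRealForm η) p = ((p.factorial * ∏ i : Fin p, d (Fin.castLE hp i) : ℕ) : ℂ) •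
      (((γM : ↥(AddSubgroup.toIntSubmodule ((integralHodgeClassesIn Φ (2 * p) p).addSubgroupOf (integralForms Φ (2 * p))))) :
        ↥(integralForms Φ (2 * p))) : E [⋀^Fin (2 * p)]→L[ℝ] ℂ))
    (Λ : Submodule ℤ ↥(AddSubgroup.toIntSubmodule ((integralHodgeClassesIn Φ (2 * p) p).addSubgroupOf (integralForms Φ (2 * p)))))
    (hΛ : ∀ x, x ∈ Λ ↔ ∃ a : ℤ, a • γM = x)
    (N : Fin (p + 1) → Submodule ℤ ↥(integralForms Φ (2 * p)))
    (hN : ∀ (s : Fin (p + 1)) (u : ↥(integralForms Φ (2 * p))), u ∈ N s ↔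
      ∃ (m i : ℕ) (_ : i + i = m) (h : 2 * (s : ℕ) + m = 2 * p) (y : E [⋀^Fin m]→L[ℝ] ℂ),
        y ∈ integralHodgeClassesIn Φ m i ∧ y ∈ primitiveForms η m ∧ (u : E [⋀^Fin (2 * p)]→L[ℝ] ℂ) = lefschetzPow η (s : ℕ) h y)
    (M : Fin (p + 1) → Submodule ℤ ↥(integralForms Φ (2 * p)))
    (hM : ∀ (s : Fin (p + 1)) (u : ↥(integralForms Φ (2 * p))), u ∈ M s ↔
      ((s : ℕ).factorial * ∏ i : Fin s, d (Fin.castLE ((Nat.le_of_lt_succ s.isLt).trans hp) i)) • u ∈ N s) :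
    (⨆ s : Fin p, M (Fin.castSucc s)).comap (AddSubgroup.toIntSubmodule ((integralHodgeClassesIn Φ (2 * p) p).addSubgroupOf (integralForms Φ (2 * p)))).subtype ≤
      (B.restrict (AddSubgroup.toIntSubmodule ((integralHodgeClassesIn Φ (2 * p) p).addSubgroupOf (integralForms Φ (2 * p))))).orthogonal Λ := by
  have hBs : B.IsSymm := hd.isSymm_of_eq_poincarePairing_wedge_of_even hη (even_two_mul p) hkq hq hγq e hn hB
  -- every lower piece is orthogonal to `Λ`
  have key : ∀ t : Fin p, (M (Fin.castSucc t)).comap (AddSubgroup.toIntSubmodule ((integralHodgeClassesIn Φ (2 * p) p).addSubgroupOf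
      (integralForms Φ (2 * p)))).subtype ≤
      (B.restrict (AddSubgroup.toIntSubmodule ((integralHodgeClassesIn Φ (2 * p) p).addSubgroupOf (integralForms Φ (2 * p))))).orthogonal Λ := by
    intro t z hz
    have hne : Fin.castSucc t ≠ Fin.last p := (Fin.castSucc_lt_last t).ne
    have h0 : B (γM : ↥(integralForms Φ (2 * p))) (z : ↥(integralForms Φ (2 * p))) = 0 :=
      hd.apply_minimalClass_eq_zero_of_mem_minimalClassPiece hη hp hkq hq hγq e hn hB (γM : ↥(integralForms Φ (2 * p))) hγM N hN M hM hne hz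
    refine LinearMap.BilinForm.mem_orthogonal_iff.2 fun x hx ↦ ?_
    obtain ⟨a, rfl⟩ := (hΛ x).1 hx
    show B (((a • γM : ↥(AddSubgroup.toIntSubmodule ((integralHodgeClassesIn Φ (2 * p) p).addSubgroupOf (integralForms Φ (2 * p)))))) :
      ↥(integralForms Φ (2 * p))) (z : ↥(integralForms Φ (2 * p))) = 0
    rw [show (((a • γM : ↥(AddSubgroup.toIntSubmodule ((integralHodgeClassesIn Φ (2 * p) p).addSubgroupOf (integralForms Φ (2 * p)))))) :
        ↥(integralForms Φ (2 * p))) = a • (γM : ↥(integralForms Φ (2 * p))) from rfl,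
      show B (a • (γM : ↥(integralForms Φ (2 * p)))) (z : ↥(integralForms Φ (2 * p))) =
        B.flip (z : ↥(integralForms Φ (2 * p))) (a • (γM : ↥(integralForms Φ (2 * p)))) from rfl, map_zsmul,
      show B.flip (z : ↥(integralForms Φ (2 * p))) (γM : ↥(integralForms Φ (2 * p))) = B (γM : ↥(integralForms Φ (2 * p))) (z : ↥(integralForms Φ (2 * p))) from rfl,
      h0, smul_zero]
  -- the pull-back of the supremum is the supremum of the pull-backs (all pieces lie in `M`)
  intro z hz
  have hle : ∀ t : Fin p, M (Fin.castSucc t) ≤ AddSubgroup.toIntSubmodule ((integralHodgeClassesIn Φ (2 * p) p).addSubgroupOf (integralForms Φ (2 * p))) :=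
    fun t ↦ hd.minimalClassPiece_le_toIntSubmodule hη hp (two_mul p).symm N hN M hM _
  have hmap : (⨆ s : Fin p, M (Fin.castSucc s)) = Submodule.map (AddSubgroup.toIntSubmodule ((integralHodgeClassesIn Φ (2 * p) p).addSubgroupOf
      (integralForms Φ (2 * p)))).subtype (⨆ s : Fin p, (M (Fin.castSucc s)).comap (AddSubgroup.toIntSubmodule ((integralHodgeClassesIn Φ (2 * p) p).addSubgroupOf
      (integralForms Φ (2 * p)))).subtype) := by
    rw [Submodule.map_iSup]
    refine iSup_congr fun t ↦ ?_
    rw [Submodule.map_comap_subtype, inf_eq_right.2 (hle t)]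
  have hz' : z ∈ ⨆ s : Fin p, (M (Fin.castSucc s)).comap (AddSubgroup.toIntSubmodule ((integralHodgeClassesIn Φ (2 * p) p).addSubgroupOf
      (integralForms Φ (2 * p)))).subtype := by
    rw [Submodule.mem_comap, hmap] at hz
    obtain ⟨w, hw, hwz⟩ := hz
    obtain rfl : w = z := Subtype.ext (by simpa using hwz)
    exact hw
  exact (iSup_le key) hz'

/-- **`⊕_{s ≤ p} M_s = ℤγ_p ⊕ (⊕_{s < p} M_s)` inside `Hdgᵖ(X, ℤ)`**: the top minimal-class piece is the line of the minimal class (`M_p = ℤγ_p`, g48-#5), the others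
are the lower pieces. [cite: Lange2023AbelianVarietiesComplex, §2.5.3 Thm. 2.5.16 (PDF p. 135); §5.4.1 (5.22) (PDF p. 275)] -/
theorem IsPolarizationType.comap_subtype_iSup_minimalClassPieces_eq_line_sup_lower (hd : IsPolarizationType Φ η d) (hη : IsRiemannForm Φ η)
    (hp : p ≤ j + 2)
    (γM : ↥(AddSubgroup.toIntSubmodule ((integralHodgeClassesIn Φ (2 * p) p).addSubgroupOf (integralForms Φ (2 * p)))))
    (hγM : wedgePow (ofRealForm η) p = ((p.factorial * ∏ i : Fin p, d (Fin.castLE hp i) : ℕ) : ℂ) •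
      (((γM : ↥(AddSubgroup.toIntSubmodule ((integralHodgeClassesIn Φ (2 * p) p).addSubgroupOf (integralForms Φ (2 * p))))) :
        ↥(integralForms Φ (2 * p))) : E [⋀^Fin (2 * p)]→L[ℝ] ℂ))
    (Λ : Submodule ℤ ↥(AddSubgroup.toIntSubmodule ((integralHodgeClassesIn Φ (2 * p) p).addSubgroupOf (integralForms Φ (2 * p)))))
    (hΛ : ∀ x, x ∈ Λ ↔ ∃ a : ℤ, a • γM = x)
    (N : Fin (p + 1) → Submodule ℤ ↥(integralForms Φ (2 * p)))
    (hN : ∀ (s : Fin (p + 1)) (u : ↥(integralForms Φ (2 * p))), u ∈ N s ↔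
      ∃ (m i : ℕ) (_ : i + i = m) (h : 2 * (s : ℕ) + m = 2 * p) (y : E [⋀^Fin m]→L[ℝ] ℂ),
        y ∈ integralHodgeClassesIn Φ m i ∧ y ∈ primitiveForms η m ∧ (u : E [⋀^Fin (2 * p)]→L[ℝ] ℂ) = lefschetzPow η (s : ℕ) h y)
    (M : Fin (p + 1) → Submodule ℤ ↥(integralForms Φ (2 * p)))
    (hM : ∀ (s : Fin (p + 1)) (u : ↥(integralForms Φ (2 * p))), u ∈ M s ↔
      ((s : ℕ).factorial * ∏ i : Fin s, d (Fin.castLE ((Nat.le_of_lt_succ s.isLt).trans hp) i)) • u ∈ N s) :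
    (⨆ s, M s).comap (AddSubgroup.toIntSubmodule ((integralHodgeClassesIn Φ (2 * p) p).addSubgroupOf (integralForms Φ (2 * p)))).subtype =
      Λ ⊔ (⨆ s : Fin p, M (Fin.castSucc s)).comap (AddSubgroup.toIntSubmodule ((integralHodgeClassesIn Φ (2 * p) p).addSubgroupOf (integralForms Φ (2 * p)))).subtype := by
  have hc : 0 < p.factorial * ∏ i : Fin p, d (Fin.castLE hp i) := Nat.mul_pos (Nat.factorial_pos p) (Finset.prod_pos fun i _ ↦ hd.pos hη _)
  have hle : ∀ s, M s ≤ AddSubgroup.toIntSubmodule ((integralHodgeClassesIn Φ (2 * p) p).addSubgroupOf (integralForms Φ (2 * p))) :=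
    fun s ↦ hd.minimalClassPiece_le_toIntSubmodule hη hp (two_mul p).symm N hN M hM s
  have hlast : (M (Fin.last p)).comap (AddSubgroup.toIntSubmodule ((integralHodgeClassesIn Φ (2 * p) p).addSubgroupOf (integralForms Φ (2 * p)))).subtype = Λ := by
    ext z
    rw [Submodule.mem_comap, Submodule.subtype_apply, mem_minimalClassPiece_last_iff hp hc (γM : ↥(integralForms Φ (2 * p))) hγM N hN M hM, hΛ]
    constructor
    · rintro ⟨a, ha⟩
      exact ⟨a, Subtype.ext ha⟩
    · rintro ⟨a, rfl⟩
      exact ⟨a, rfl⟩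
  rw [iSup_eq_last_sup_iSup_castSucc₉₈ M, comap_subtype_sup_of_le₉₈ _ _ _ (hle _) (iSup_le fun t ↦ hle _), hlast]

end Lower

/-! ## §2 The defect formula `I'_p = J_p · [γ_p^⊥ : ⊕_{s < p} M_s]` -/

section Defect

variable {ι : Type*} [Fintype ι] [DecidableEq ι] {E : Type*} [NormedAddCommGroup E] [NormedSpace ℂ E]
  {Φ : (ι → ℝ) ≃L[ℝ] E} {j n p q : ℕ} {η : E [⋀^Fin 2]→L[ℝ] ℝ} {d : Fin (j + 2) → ℕ}

/-- **THE DEFECT FORMULA `I'_p = J_p · D_p`**: the index `I'_p = [Hdgᵖ(X, ℤ) : ⊕_{s ≤ p} γ_s ∧ Hdg^{p−s}(X, ℤ)_prim]` of the minimal-class decomposition (g48-#4) is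
the index `J_p = [Hdgᵖ(X, ℤ) : ℤγ_p ⊕ γ_p^⊥]` of the top splitting (g48-#5) times the DEFECT **`D_p = [γ_p^⊥ : ⊕_{s < p} γ_s ∧ Hdg^{p−s}(X, ℤ)_prim]`** of the lower
pieces inside the orthogonal complement of the minimal class (`⊕_{s ≤ p} M_s = ℤγ_p ⊕ ⊕_{s<p} M_s ⊆ ℤγ_p ⊕ γ_p^⊥`, `ℤγ_p ∩ γ_p^⊥ = 0`, and
`[A ⊕ B : A ⊕ B'] = [B : B']`); `0 < D_p`, `0 < J_p`, `D_p ∣ I'_p`. Stated on the sub-module `M = Hdgᵖ(X, ℤ) ⊆ H^{2p}(X, ℤ)` and, for `I'_p`, also as the pull-back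
along `Hdgᵖ(X, ℤ) ↪ H^{2p}(X, ℤ)` (g47-#4's currency). [cite: Lange2023AbelianVarietiesComplex, §5.4.1 Thm. 5.4.2 and (5.22)–(5.23) (PDF p. 275); §7.3.2 (3)] [cite: Kaplansky1954, §7 Thm. 5 (PDF p. 18)] [cite: Huybrechts2016K3, Ch. 14 §0.1–§0.2] [cite: Kitaoka1993, Ch. 5 Prop. 5.3.3 (proof)] -/
theorem IsPolarizationType.index_comap_iSup_minimalClassPieces_eq_index_top_splitting_mul_relIndex_lower (hd : IsPolarizationType Φ η d) (hη : IsRiemannForm Φ η)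
    (hp : p ≤ j + 2) (hkq : 2 * p + q = j + 2) (hq : q ≤ j + 2)
    {γq : E [⋀^Fin (2 * q)]→L[ℝ] ℂ} (hγq : wedgePow (ofRealForm η) q = ((q.factorial * ∏ i : Fin q, d (Fin.castLE hq i) : ℕ) : ℂ) • γq)
    (e : Fin n ≃ ι) (hn : 2 * p + (2 * q + 2 * p) = n) {B : BilinForm ℤ ↥(integralForms Φ (2 * p))}
    (hB : ∀ x y : ↥(integralForms Φ (2 * p)),
      ((B x y : ℤ) : ℂ) = poincarePairing Φ e hn (x : E [⋀^Fin (2 * p)]→L[ℝ] ℂ) (γq.wedge (y : E [⋀^Fin (2 * p)]→L[ℝ] ℂ)))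
    (γM : ↥(AddSubgroup.toIntSubmodule ((integralHodgeClassesIn Φ (2 * p) p).addSubgroupOf (integralForms Φ (2 * p)))))
    (hγM : wedgePow (ofRealForm η) p = ((p.factorial * ∏ i : Fin p, d (Fin.castLE hp i) : ℕ) : ℂ) •
      (((γM : ↥(AddSubgroup.toIntSubmodule ((integralHodgeClassesIn Φ (2 * p) p).addSubgroupOf (integralForms Φ (2 * p))))) : ↥(integralForms Φ (2 * p))) : E [⋀^Fin (2 * p)]→L[ℝ] ℂ))
    (Λ : Submodule ℤ ↥(AddSubgroup.toIntSubmodule ((integralHodgeClassesIn Φ (2 * p) p).addSubgroupOf (integralForms Φ (2 * p))))) (hΛ : ∀ x, x ∈ Λ ↔ ∃ a : ℤ, a • γM = x)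
    (N : Fin (p + 1) → Submodule ℤ ↥(integralForms Φ (2 * p)))
    (hN : ∀ (s : Fin (p + 1)) (u : ↥(integralForms Φ (2 * p))), u ∈ N s ↔
      ∃ (m i : ℕ) (_ : i + i = m) (h : 2 * (s : ℕ) + m = 2 * p) (y : E [⋀^Fin m]→L[ℝ] ℂ),
        y ∈ integralHodgeClassesIn Φ m i ∧ y ∈ primitiveForms η m ∧ (u : E [⋀^Fin (2 * p)]→L[ℝ] ℂ) = lefschetzPow η (s : ℕ) h y)
    (M : Fin (p + 1) → Submodule ℤ ↥(integralForms Φ (2 * p)))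
    (hM : ∀ (s : Fin (p + 1)) (u : ↥(integralForms Φ (2 * p))), u ∈ M s ↔
      ((s : ℕ).factorial * ∏ i : Fin s, d (Fin.castLE ((Nat.le_of_lt_succ s.isLt).trans hp) i)) • u ∈ N s) :
    ((⨆ s, M s).comap (AddSubgroup.toIntSubmodule ((integralHodgeClassesIn Φ (2 * p) p).addSubgroupOf (integralForms Φ (2 * p)))).subtype).toAddSubgroup.index =
        (Λ ⊔ (B.restrict (AddSubgroup.toIntSubmodule ((integralHodgeClassesIn Φ (2 * p) p).addSubgroupOf (integralForms Φ (2 * p))))).orthogonal Λ).toAddSubgroup.index *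
          ((⨆ s : Fin p, M (Fin.castSucc s)).comap (AddSubgroup.toIntSubmodule ((integralHodgeClassesIn Φ (2 * p) p).addSubgroupOf (integralForms Φ (2 * p)))).subtype).toAddSubgroup.relIndex ((B.restrict (AddSubgroup.toIntSubmodule ((integralHodgeClassesIn Φ (2 * p) p).addSubgroupOf (integralForms Φ (2 * p))))).orthogonal Λ).toAddSubgroup ∧
      ((⨆ s, M s).comap (AddSubgroup.inclusion (integralHodgeClassesIn_le_integralForms Φ (2 * p) p)).toIntLinearMap).toAddSubgroup.index =
        (Λ ⊔ (B.restrict (AddSubgroup.toIntSubmodule ((integralHodgeClassesIn Φ (2 * p) p).addSubgroupOf (integralForms Φ (2 * p))))).orthogonal Λ).toAddSubgroup.index *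
          ((⨆ s : Fin p, M (Fin.castSucc s)).comap (AddSubgroup.toIntSubmodule ((integralHodgeClassesIn Φ (2 * p) p).addSubgroupOf (integralForms Φ (2 * p)))).subtype).toAddSubgroup.relIndex ((B.restrict (AddSubgroup.toIntSubmodule ((integralHodgeClassesIn Φ (2 * p) p).addSubgroupOf (integralForms Φ (2 * p))))).orthogonal Λ).toAddSubgroup ∧
      0 < ((⨆ s : Fin p, M (Fin.castSucc s)).comap (AddSubgroup.toIntSubmodule ((integralHodgeClassesIn Φ (2 * p) p).addSubgroupOf (integralForms Φ (2 * p)))).subtype).toAddSubgroup.relIndex ((B.restrict (AddSubgroup.toIntSubmodule ((integralHodgeClassesIn Φ (2 * p) p).addSubgroupOf (integralForms Φ (2 * p))))).orthogonal Λ).toAddSubgroup ∧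
      0 < (Λ ⊔ (B.restrict (AddSubgroup.toIntSubmodule ((integralHodgeClassesIn Φ (2 * p) p).addSubgroupOf (integralForms Φ (2 * p))))).orthogonal Λ).toAddSubgroup.index ∧
      ((⨆ s : Fin p, M (Fin.castSucc s)).comap (AddSubgroup.toIntSubmodule ((integralHodgeClassesIn Φ (2 * p) p).addSubgroupOf (integralForms Φ (2 * p)))).subtype).toAddSubgroup.relIndex ((B.restrict (AddSubgroup.toIntSubmodule ((integralHodgeClassesIn Φ (2 * p) p).addSubgroupOf (integralForms Φ (2 * p))))).orthogonal Λ).toAddSubgroup ∣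
        ((⨆ s, M s).comap (AddSubgroup.toIntSubmodule ((integralHodgeClassesIn Φ (2 * p) p).addSubgroupOf (integralForms Φ (2 * p)))).subtype).toAddSubgroup.index := by
  have hg : p + (q + p) = j + 2 := by omega
  have hsplit := hd.comap_subtype_iSup_minimalClassPieces_eq_line_sup_lower hη hp γM hγM Λ hΛ N hN M hM
  have hlow := hd.comap_subtype_lower_minimalClassPieces_le_orthogonal hη hp hkq hq hγq e hn hB γM hγM Λ hΛ N hN M hM
  have hinf := (hd.top_splitting hη hp hq hg hγq e hn hB γM hγM Λ hΛ).1
  have hJ := (hd.index_top_splitting_mul_index_range_mul_content_eq hη hp hq hg hγq e hn hB γM hγM Λ hΛ).2.2.1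
  have hle : (Λ ⊔ (⨆ s : Fin p, M (Fin.castSucc s)).comap (AddSubgroup.toIntSubmodule ((integralHodgeClassesIn Φ (2 * p) p).addSubgroupOf (integralForms Φ (2 * p)))).subtype).toAddSubgroup ≤ (Λ ⊔ (B.restrict (AddSubgroup.toIntSubmodule ((integralHodgeClassesIn Φ (2 * p) p).addSubgroupOf (integralForms Φ (2 * p))))).orthogonal Λ).toAddSubgroup :=
    Submodule.toAddSubgroup_mono (sup_le_sup_left hlow Λ)
  have hrel := relIndex_sup_left_eq₉₈ hinf hlow
  -- `I'_p = [M : Λ ⊕ Low] = [Λ ⊕ Λ^⊥ : Λ ⊕ Low] · J_p = D_p · J_p` (no rewriting inside the big lattice terms: congruence and transitivity only)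
  have step1 : ((⨆ s, M s).comap (AddSubgroup.toIntSubmodule ((integralHodgeClassesIn Φ (2 * p) p).addSubgroupOf (integralForms Φ (2 * p)))).subtype).toAddSubgroup.index = (Λ ⊔ (⨆ s : Fin p, M (Fin.castSucc s)).comap (AddSubgroup.toIntSubmodule ((integralHodgeClassesIn Φ (2 * p) p).addSubgroupOf (integralForms Φ (2 * p)))).subtype).toAddSubgroup.index :=
    congrArg (fun S : Submodule ℤ ↥(AddSubgroup.toIntSubmodule ((integralHodgeClassesIn Φ (2 * p) p).addSubgroupOf (integralForms Φ (2 * p)))) ↦ S.toAddSubgroup.index) hsplit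
  have key : ((⨆ s, M s).comap (AddSubgroup.toIntSubmodule ((integralHodgeClassesIn Φ (2 * p) p).addSubgroupOf (integralForms Φ (2 * p)))).subtype).toAddSubgroup.index =
      (Λ ⊔ (B.restrict (AddSubgroup.toIntSubmodule ((integralHodgeClassesIn Φ (2 * p) p).addSubgroupOf (integralForms Φ (2 * p))))).orthogonal Λ).toAddSubgroup.index *
        ((⨆ s : Fin p, M (Fin.castSucc s)).comap (AddSubgroup.toIntSubmodule ((integralHodgeClassesIn Φ (2 * p) p).addSubgroupOf (integralForms Φ (2 * p)))).subtype).toAddSubgroup.relIndex ((B.restrict (AddSubgroup.toIntSubmodule ((integralHodgeClassesIn Φ (2 * p) p).addSubgroupOf (integralForms Φ (2 * p))))).orthogonal Λ).toAddSubgroup :=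
    step1.trans ((AddSubgroup.relIndex_mul_index hle).symm.trans
      ((congrArg (· * (Λ ⊔ (B.restrict (AddSubgroup.toIntSubmodule ((integralHodgeClassesIn Φ (2 * p) p).addSubgroupOf (integralForms Φ (2 * p))))).orthogonal Λ).toAddSubgroup.index) hrel).trans (mul_comm _ _)))
  -- the inclusion currency and positivity of `I'_p`
  have hM' : ∀ x : ↥(integralForms Φ (2 * p)), x ∈ (AddSubgroup.toIntSubmodule ((integralHodgeClassesIn Φ (2 * p) p).addSubgroupOf (integralForms Φ (2 * p)))) ↔ IsOfTypeAt p p (x : E [⋀^Fin (2 * p)]→L[ℝ] ℂ) := fun x ↦ by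
    change x ∈ (integralHodgeClassesIn Φ (2 * p) p).addSubgroupOf (integralForms Φ (2 * p)) ↔ _
    rw [AddSubgroup.mem_addSubgroupOf, mem_integralHodgeClassesIn_iff, mem_typeSubmodule_iff_isOfTypeAt (two_mul p).symm]
    exact ⟨fun h ↦ h.2, fun h ↦ ⟨x.2, h⟩⟩
  have hcur := index_comap_subtype_eq_index_comap_inclusion (two_mul p).symm hM' (⨆ s, M s)
  have key' := hcur.symm.trans key
  have hpos := (hd.index_comap_iSup_lefschetzPieces_eq_prod_mul hη (two_mul p).symm (by omega) N hN hp M hM).2.2.2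
  exact ⟨key, key', pos_of_eq_mul_of_pos₉₈ key' hpos, hJ, Dvd.intro_left _ key.symm⟩

/-- **`D_p = 1 ⟺ I'_p = J_p ⟺ γ_p^⊥ = ⊕_{s < p} γ_s ∧ Hdg^{p−s}(X, ℤ)_prim`**: the minimal-class decomposition is the top splitting exactly when the lower
minimal-class pieces fill the orthogonal complement of the minimal class. [cite: Lange2023AbelianVarietiesComplex, §5.4.1 (5.22)–(5.23) (PDF p. 275)] [cite: Huybrechts2016K3, Ch. 14 §0.1–§0.2] -/
theorem IsPolarizationType.relIndex_lower_eq_one_iff (hd : IsPolarizationType Φ η d) (hη : IsRiemannForm Φ η)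
    (hp : p ≤ j + 2) (hkq : 2 * p + q = j + 2) (hq : q ≤ j + 2)
    {γq : E [⋀^Fin (2 * q)]→L[ℝ] ℂ} (hγq : wedgePow (ofRealForm η) q = ((q.factorial * ∏ i : Fin q, d (Fin.castLE hq i) : ℕ) : ℂ) • γq)
    (e : Fin n ≃ ι) (hn : 2 * p + (2 * q + 2 * p) = n) {B : BilinForm ℤ ↥(integralForms Φ (2 * p))}
    (hB : ∀ x y : ↥(integralForms Φ (2 * p)),
      ((B x y : ℤ) : ℂ) = poincarePairing Φ e hn (x : E [⋀^Fin (2 * p)]→L[ℝ] ℂ) (γq.wedge (y : E [⋀^Fin (2 * p)]→L[ℝ] ℂ)))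
    (γM : ↥(AddSubgroup.toIntSubmodule ((integralHodgeClassesIn Φ (2 * p) p).addSubgroupOf (integralForms Φ (2 * p)))))
    (hγM : wedgePow (ofRealForm η) p = ((p.factorial * ∏ i : Fin p, d (Fin.castLE hp i) : ℕ) : ℂ) •
      (((γM : ↥(AddSubgroup.toIntSubmodule ((integralHodgeClassesIn Φ (2 * p) p).addSubgroupOf (integralForms Φ (2 * p))))) : ↥(integralForms Φ (2 * p))) : E [⋀^Fin (2 * p)]→L[ℝ] ℂ))
    (Λ : Submodule ℤ ↥(AddSubgroup.toIntSubmodule ((integralHodgeClassesIn Φ (2 * p) p).addSubgroupOf (integralForms Φ (2 * p))))) (hΛ : ∀ x, x ∈ Λ ↔ ∃ a : ℤ, a • γM = x)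
    (N : Fin (p + 1) → Submodule ℤ ↥(integralForms Φ (2 * p)))
    (hN : ∀ (s : Fin (p + 1)) (u : ↥(integralForms Φ (2 * p))), u ∈ N s ↔
      ∃ (m i : ℕ) (_ : i + i = m) (h : 2 * (s : ℕ) + m = 2 * p) (y : E [⋀^Fin m]→L[ℝ] ℂ),
        y ∈ integralHodgeClassesIn Φ m i ∧ y ∈ primitiveForms η m ∧ (u : E [⋀^Fin (2 * p)]→L[ℝ] ℂ) = lefschetzPow η (s : ℕ) h y)
    (M : Fin (p + 1) → Submodule ℤ ↥(integralForms Φ (2 * p)))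
    (hM : ∀ (s : Fin (p + 1)) (u : ↥(integralForms Φ (2 * p))), u ∈ M s ↔
      ((s : ℕ).factorial * ∏ i : Fin s, d (Fin.castLE ((Nat.le_of_lt_succ s.isLt).trans hp) i)) • u ∈ N s) :
    (((⨆ s : Fin p, M (Fin.castSucc s)).comap (AddSubgroup.toIntSubmodule ((integralHodgeClassesIn Φ (2 * p) p).addSubgroupOf (integralForms Φ (2 * p)))).subtype).toAddSubgroup.relIndex ((B.restrict (AddSubgroup.toIntSubmodule ((integralHodgeClassesIn Φ (2 * p) p).addSubgroupOf (integralForms Φ (2 * p))))).orthogonal Λ).toAddSubgroup = 1 ↔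
        (⨆ s : Fin p, M (Fin.castSucc s)).comap (AddSubgroup.toIntSubmodule ((integralHodgeClassesIn Φ (2 * p) p).addSubgroupOf (integralForms Φ (2 * p)))).subtype = (B.restrict (AddSubgroup.toIntSubmodule ((integralHodgeClassesIn Φ (2 * p) p).addSubgroupOf (integralForms Φ (2 * p))))).orthogonal Λ) ∧
      (((⨆ s : Fin p, M (Fin.castSucc s)).comap (AddSubgroup.toIntSubmodule ((integralHodgeClassesIn Φ (2 * p) p).addSubgroupOf (integralForms Φ (2 * p)))).subtype).toAddSubgroup.relIndex ((B.restrict (AddSubgroup.toIntSubmodule ((integralHodgeClassesIn Φ (2 * p) p).addSubgroupOf (integralForms Φ (2 * p))))).orthogonal Λ).toAddSubgroup = 1 ↔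
        ((⨆ s, M s).comap (AddSubgroup.toIntSubmodule ((integralHodgeClassesIn Φ (2 * p) p).addSubgroupOf (integralForms Φ (2 * p)))).subtype).toAddSubgroup.index = (Λ ⊔ (B.restrict (AddSubgroup.toIntSubmodule ((integralHodgeClassesIn Φ (2 * p) p).addSubgroupOf (integralForms Φ (2 * p))))).orthogonal Λ).toAddSubgroup.index) := by
  have h := hd.index_comap_iSup_minimalClassPieces_eq_index_top_splitting_mul_relIndex_lower hη hp hkq hq hγq e hn hB γM hγM Λ hΛ N hN M hM
  have hlow := hd.comap_subtype_lower_minimalClassPieces_le_orthogonal hη hp hkq hq hγq e hn hB γM hγM Λ hΛ N hN M hM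
  refine ⟨?_, ⟨fun h1 ↦ eq_of_eq_mul_of_eq_one₉₈ h.1 h1, fun hIJ ↦ eq_one_of_eq_mul_of_eq₉₈ h.1 hIJ h.2.2.2.1⟩⟩
  rw [AddSubgroup.relIndex_eq_one]
  exact ⟨fun hge ↦ le_antisymm hlow fun x hx ↦ hge hx, fun heq ↦ le_of_eq (congrArg Submodule.toAddSubgroup heq.symm)⟩

end Defect

/-! ## §3 The `p = 1` end: `γ₁^⊥ = Hdg¹(X, ℤ)_prim`, `D_1 = 1`, `I'_1 = J_1` -/

section DegreeTwo

variable {ι : Type*} [Fintype ι] [DecidableEq ι] {E : Type*} [NormedAddCommGroup E] [NormedSpace ℂ E]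
  {Φ : (ι → ℝ) ≃L[ℝ] E} {j n : ℕ} {η : E [⋀^Fin 2]→L[ℝ] ℝ} {d : Fin (j + 2) → ℕ}

omit [Fintype ι] [DecidableEq ι] in
/-- `θ^{∧1} = θ` for a `2`-form. [folklore] -/
private theorem wedgePow_one_eq₉₈ (θ : E [⋀^Fin 2]→L[ℝ] ℂ) : wedgePow θ 1 = θ := by
  rw [wedgePow_one, Literature.Analysis.Complex.oneForm₀, ContinuousAlternatingMap.constOfIsEmpty_one_wedge]
  ext v
  rfl

omit [DecidableEq ι] in
/-- `dim_ℂ E = g` for a polarised torus of type `(d₁, …, d_g)` (`rk Λ = 2g`). [cite: Lange2023AbelianVarietiesComplex, §1.5.1 (PDF p. 51)] -/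
private theorem finrank_complex_eq₉₈ (hd : IsPolarizationType Φ η d) : finrank ℂ E = j + 2 := by
  have hcard : Fintype.card ι = 2 * (j + 2) := hd.card_eq
  let e : Fin (2 * (j + 2)) ≃ ι := (Fintype.equivFinOfCardEq hcard).symm
  have h1 := finrank_real_of_complex E
  have h2 := finrank_real_eq Φ e
  omega

/-- **THE `p = 1` END: `γ₁^⊥ = Hdg¹(X, ℤ)_prim` inside `Hdg¹(X, ℤ)`** for the Lefschetz form `B₂ = ⟨·, γ_{g−2} ∧ ·⟩_e` of `H²(X, ℤ)` and the primitive polarisation class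
`γ₁ = θ/d₁`: an integral Hodge class `x` of degree `2` with `⟨γ₁, γ_{g−2} ∧ x⟩ = 0` has `θ^{∧(g−1)} ∧ x = 0` (g42-#8), i.e. is primitive — so the lower minimal-class
piece `M_0 = γ_0 ∧ Hdg¹(X, ℤ)_prim = Hdg¹(X, ℤ)_prim` IS the orthogonal complement of the minimal class.
[cite: Lange2023AbelianVarietiesComplex, §5.4.1 Thm. 5.4.1, Thm. 5.4.2 and (5.22) (PDF p. 275); §7.3.2 (1)] [cite: VoisinHodgeI2002, §6.2.3 Thm. 6.25, Cor. 6.26 (PDF pp. 125–126); §6.3.2 Lemma 6.31] -/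
theorem IsPolarizationType.comap_subtype_lower_minimalClassPieces_eq_orthogonal_of_degree_two (hd : IsPolarizationType Φ η d) (hη : IsRiemannForm Φ η)
    (hp : 1 ≤ j + 2) (hkq : 2 * 1 + j = j + 2) (hq : j ≤ j + 2)
    {γq : E [⋀^Fin (2 * j)]→L[ℝ] ℂ} (hγq : wedgePow (ofRealForm η) j = ((j.factorial * ∏ i : Fin j, d (Fin.castLE hq i) : ℕ) : ℂ) • γq)
    (e : Fin n ≃ ι) (hn : 2 * 1 + (2 * j + 2 * 1) = n) {B : BilinForm ℤ ↥(integralForms Φ (2 * 1))}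
    (hB : ∀ x y : ↥(integralForms Φ (2 * 1)),
      ((B x y : ℤ) : ℂ) = poincarePairing Φ e hn (x : E [⋀^Fin (2 * 1)]→L[ℝ] ℂ) (γq.wedge (y : E [⋀^Fin (2 * 1)]→L[ℝ] ℂ)))
    (γM : ↥(AddSubgroup.toIntSubmodule ((integralHodgeClassesIn Φ (2 * 1) 1).addSubgroupOf (integralForms Φ (2 * 1)))))
    (hγM : wedgePow (ofRealForm η) 1 = ((Nat.factorial 1 * ∏ i : Fin 1, d (Fin.castLE hp i) : ℕ) : ℂ) •
      (((γM : ↥(AddSubgroup.toIntSubmodule ((integralHodgeClassesIn Φ (2 * 1) 1).addSubgroupOf (integralForms Φ (2 * 1))))) : ↥(integralForms Φ (2 * 1))) : E [⋀^Fin (2 * 1)]→L[ℝ] ℂ))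
    (Λ : Submodule ℤ ↥(AddSubgroup.toIntSubmodule ((integralHodgeClassesIn Φ (2 * 1) 1).addSubgroupOf (integralForms Φ (2 * 1))))) (hΛ : ∀ x, x ∈ Λ ↔ ∃ a : ℤ, a • γM = x)
    (N : Fin (1 + 1) → Submodule ℤ ↥(integralForms Φ (2 * 1)))
    (hN : ∀ (s : Fin (1 + 1)) (u : ↥(integralForms Φ (2 * 1))), u ∈ N s ↔
      ∃ (m i : ℕ) (_ : i + i = m) (h : 2 * (s : ℕ) + m = 2 * 1) (y : E [⋀^Fin m]→L[ℝ] ℂ),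
        y ∈ integralHodgeClassesIn Φ m i ∧ y ∈ primitiveForms η m ∧ (u : E [⋀^Fin (2 * 1)]→L[ℝ] ℂ) = lefschetzPow η (s : ℕ) h y)
    (M : Fin (1 + 1) → Submodule ℤ ↥(integralForms Φ (2 * 1)))
    (hM : ∀ (s : Fin (1 + 1)) (u : ↥(integralForms Φ (2 * 1))), u ∈ M s ↔
      ((s : ℕ).factorial * ∏ i : Fin s, d (Fin.castLE ((Nat.le_of_lt_succ s.isLt).trans hp) i)) • u ∈ N s) :
    (⨆ s : Fin 1, M (Fin.castSucc s)).comap (AddSubgroup.toIntSubmodule ((integralHodgeClassesIn Φ (2 * 1) 1).addSubgroupOf (integralForms Φ (2 * 1)))).subtype = (B.restrict (AddSubgroup.toIntSubmodule ((integralHodgeClassesIn Φ (2 * 1) 1).addSubgroupOf (integralForms Φ (2 * 1))))).orthogonal Λ := by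
  refine le_antisymm (hd.comap_subtype_lower_minimalClassPieces_le_orthogonal hη hp hkq hq hγq e hn hB γM hγM Λ hΛ N hN M hM) fun z hz ↦ ?_
  -- `B(γ₁, z) = 0`
  have hγΛ : γM ∈ Λ := (hΛ γM).2 ⟨1, one_smul _ _⟩
  have h0 : B (γM : ↥(integralForms Φ (2 * 1))) (z : ↥(integralForms Φ (2 * 1))) = 0 := (LinearMap.BilinForm.mem_orthogonal_iff.1 hz) γM hγΛ
  -- `θ = d₁ · γ₁`, so `⟨θ, γ_{g−2} ∧ z⟩ = 0`
  have hθ : ofRealForm η = ((Nat.factorial 1 * ∏ i : Fin 1, d (Fin.castLE hp i) : ℕ) : ℂ) •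
      (((γM : ↥(AddSubgroup.toIntSubmodule ((integralHodgeClassesIn Φ (2 * 1) 1).addSubgroupOf (integralForms Φ (2 * 1))))) : ↥(integralForms Φ (2 * 1))) : E [⋀^Fin (2 * 1)]→L[ℝ] ℂ) := by
    rw [← hγM, wedgePow_one_eq₉₈]
  have hn' : 2 + (2 * j + 2) = n := by omega
  have hpair : poincarePairing Φ e hn' (ofRealForm η) (γq.wedge ((z : ↥(integralForms Φ (2 * 1))) : E [⋀^Fin (2 * 1)]→L[ℝ] ℂ)) = 0 := by
    have h1 : poincarePairing Φ e hn' (ofRealForm η) (γq.wedge ((z : ↥(integralForms Φ (2 * 1))) : E [⋀^Fin (2 * 1)]→L[ℝ] ℂ)) =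
        poincarePairing Φ e hn (ofRealForm η) (γq.wedge ((z : ↥(integralForms Φ (2 * 1))) : E [⋀^Fin (2 * 1)]→L[ℝ] ℂ)) := rfl
    rw [h1, hθ, map_smul, LinearMap.smul_apply, ← hB, h0, Int.cast_zero, smul_zero]
  -- hence `z` is primitive
  have hprim : ((z : ↥(integralForms Φ (2 * 1))) : E [⋀^Fin (2 * 1)]→L[ℝ] ℂ) ∈ primitiveForms η 2 := by
    rw [mem_primitiveForms_iff_of_add_eq η (show 2 + j = finrank ℂ E by rw [finrank_complex_eq₉₈ hd]; omega)]
    exact (hd.poincarePairing_ofRealForm_wedge_eq_zero_iff_of_eq_content_smul hη hq hγq e hn' _).1 hpair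
  have hHdg : ((z : ↥(integralForms Φ (2 * 1))) : E [⋀^Fin (2 * 1)]→L[ℝ] ℂ) ∈ integralHodgeClassesIn Φ 2 1 :=
    AddSubgroup.mem_addSubgroupOf.1 z.2
  -- so `z ∈ M_0`
  have hz0 : (z : ↥(integralForms Φ (2 * 1))) ∈ M (Fin.castSucc 0) := by
    rw [hM]
    have hc : ((Fin.castSucc (0 : Fin 1) : Fin (1 + 1)) : ℕ).factorial *
        ∏ i : Fin (Fin.castSucc (0 : Fin 1) : Fin (1 + 1)), d (Fin.castLE ((Nat.le_of_lt_succ (Fin.castSucc (0 : Fin 1)).isLt).trans hp) i) = 1 := by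
      rfl
    rw [hc, one_smul, hN]
    exact ⟨2, 1, rfl, rfl, _, hHdg, hprim, (lefschetzPow_zero_apply η _ _).symm⟩
  rw [Submodule.mem_comap, Submodule.subtype_apply]
  exact Submodule.mem_iSup_of_mem (0 : Fin 1) hz0

/-- **`I'_1 = J_1`: FOR DIVISOR CLASSES THE MINIMAL-CLASS DECOMPOSITION IS THE TOP SPLITTING**, `[Hdg¹(X, ℤ) : ℤγ₁ ⊕ Hdg¹(X, ℤ)_prim] = [Hdg¹(X, ℤ) : ℤγ₁ ⊕ γ₁^⊥]`
(`D_1 = 1`), in both currencies; hence (g48-#4) `I_1 = d₁ · J_1` and (g48-#6) `J_1 · n₁ · d₁ = g · d_g`.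
[cite: Lange2023AbelianVarietiesComplex, §5.4.1 Thm. 5.4.2 and (5.22)–(5.23) (PDF p. 275); §2.5.3 Cor. 2.5.17 (d) (PDF p. 135)] [cite: VoisinHodgeI2002, §6.2.3 Cor. 6.26; §6.3.2 Lemma 6.31] [cite: Kitaoka1993, Ch. 5 Prop. 5.3.3 (proof)] -/
theorem IsPolarizationType.index_comap_iSup_minimalClassPieces_eq_index_top_splitting_of_degree_two (hd : IsPolarizationType Φ η d)
    (hη : IsRiemannForm Φ η) (hp : 1 ≤ j + 2) (hkq : 2 * 1 + j = j + 2) (hq : j ≤ j + 2)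
    {γq : E [⋀^Fin (2 * j)]→L[ℝ] ℂ} (hγq : wedgePow (ofRealForm η) j = ((j.factorial * ∏ i : Fin j, d (Fin.castLE hq i) : ℕ) : ℂ) • γq)
    (e : Fin n ≃ ι) (hn : 2 * 1 + (2 * j + 2 * 1) = n) {B : BilinForm ℤ ↥(integralForms Φ (2 * 1))}
    (hB : ∀ x y : ↥(integralForms Φ (2 * 1)),
      ((B x y : ℤ) : ℂ) = poincarePairing Φ e hn (x : E [⋀^Fin (2 * 1)]→L[ℝ] ℂ) (γq.wedge (y : E [⋀^Fin (2 * 1)]→L[ℝ] ℂ)))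
    (γM : ↥(AddSubgroup.toIntSubmodule ((integralHodgeClassesIn Φ (2 * 1) 1).addSubgroupOf (integralForms Φ (2 * 1)))))
    (hγM : wedgePow (ofRealForm η) 1 = ((Nat.factorial 1 * ∏ i : Fin 1, d (Fin.castLE hp i) : ℕ) : ℂ) •
      (((γM : ↥(AddSubgroup.toIntSubmodule ((integralHodgeClassesIn Φ (2 * 1) 1).addSubgroupOf (integralForms Φ (2 * 1))))) : ↥(integralForms Φ (2 * 1))) : E [⋀^Fin (2 * 1)]→L[ℝ] ℂ))
    (Λ : Submodule ℤ ↥(AddSubgroup.toIntSubmodule ((integralHodgeClassesIn Φ (2 * 1) 1).addSubgroupOf (integralForms Φ (2 * 1))))) (hΛ : ∀ x, x ∈ Λ ↔ ∃ a : ℤ, a • γM = x)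
    (N : Fin (1 + 1) → Submodule ℤ ↥(integralForms Φ (2 * 1)))
    (hN : ∀ (s : Fin (1 + 1)) (u : ↥(integralForms Φ (2 * 1))), u ∈ N s ↔
      ∃ (m i : ℕ) (_ : i + i = m) (h : 2 * (s : ℕ) + m = 2 * 1) (y : E [⋀^Fin m]→L[ℝ] ℂ),
        y ∈ integralHodgeClassesIn Φ m i ∧ y ∈ primitiveForms η m ∧ (u : E [⋀^Fin (2 * 1)]→L[ℝ] ℂ) = lefschetzPow η (s : ℕ) h y)
    (M : Fin (1 + 1) → Submodule ℤ ↥(integralForms Φ (2 * 1)))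
    (hM : ∀ (s : Fin (1 + 1)) (u : ↥(integralForms Φ (2 * 1))), u ∈ M s ↔
      ((s : ℕ).factorial * ∏ i : Fin s, d (Fin.castLE ((Nat.le_of_lt_succ s.isLt).trans hp) i)) • u ∈ N s) :
    ((⨆ s : Fin 1, M (Fin.castSucc s)).comap (AddSubgroup.toIntSubmodule ((integralHodgeClassesIn Φ (2 * 1) 1).addSubgroupOf (integralForms Φ (2 * 1)))).subtype).toAddSubgroup.relIndex ((B.restrict (AddSubgroup.toIntSubmodule ((integralHodgeClassesIn Φ (2 * 1) 1).addSubgroupOf (integralForms Φ (2 * 1))))).orthogonal Λ).toAddSubgroup = 1 ∧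
      ((⨆ s, M s).comap (AddSubgroup.toIntSubmodule ((integralHodgeClassesIn Φ (2 * 1) 1).addSubgroupOf (integralForms Φ (2 * 1)))).subtype).toAddSubgroup.index = (Λ ⊔ (B.restrict (AddSubgroup.toIntSubmodule ((integralHodgeClassesIn Φ (2 * 1) 1).addSubgroupOf (integralForms Φ (2 * 1))))).orthogonal Λ).toAddSubgroup.index ∧
      ((⨆ s, M s).comap (AddSubgroup.inclusion (integralHodgeClassesIn_le_integralForms Φ (2 * 1) 1)).toIntLinearMap).toAddSubgroup.index =
        (Λ ⊔ (B.restrict (AddSubgroup.toIntSubmodule ((integralHodgeClassesIn Φ (2 * 1) 1).addSubgroupOf (integralForms Φ (2 * 1))))).orthogonal Λ).toAddSubgroup.index ∧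
      (⨆ s, M s).comap (AddSubgroup.toIntSubmodule ((integralHodgeClassesIn Φ (2 * 1) 1).addSubgroupOf (integralForms Φ (2 * 1)))).subtype = Λ ⊔ (B.restrict (AddSubgroup.toIntSubmodule ((integralHodgeClassesIn Φ (2 * 1) 1).addSubgroupOf (integralForms Φ (2 * 1))))).orthogonal Λ := by
  have heq := hd.comap_subtype_lower_minimalClassPieces_eq_orthogonal_of_degree_two hη hp hkq hq hγq e hn hB γM hγM Λ hΛ N hN M hM
  have hiff := hd.relIndex_lower_eq_one_iff hη hp hkq hq hγq e hn hB γM hγM Λ hΛ N hN M hM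
  have h := hd.index_comap_iSup_minimalClassPieces_eq_index_top_splitting_mul_relIndex_lower hη hp hkq hq hγq e hn hB γM hγM Λ hΛ N hN M hM
  have h1 := hiff.1.2 heq
  refine ⟨h1, hiff.2.1 h1, eq_of_eq_mul_of_eq_one₉₈ h.2.1 h1, ?_⟩
  rw [hd.comap_subtype_iSup_minimalClassPieces_eq_line_sup_lower hη hp γM hγM Λ hΛ N hN M hM, heq]

end DegreeTwo

end Literature.Geometry.Kaehler.ComplexTorus

end
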